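import Summits.QuantumFields.YangMills.Theorems.BalabanUVNodesK1R8RowsDefs
import Summits.QuantumFields.YangMills.Theorems.BalabanUVNodesK1EndCriterionCeilingFree
import Literature.MathematicalPhysics.QuantumFieldTheory.Balaban1983to89.Node00.Record13SepCoPHV

/-!
# K1⁹ `StabilityBRunRowsAtRecordR13SepCoPHV` (stmt-QuantumFields-27364, crux r3 DECIDING, route rev 28∕29): ITS `∃ γ₁` WINDOW CONJUNCT IS IDLE —
# row (i) gives the window at EVERY version slot; the crux ⟺ its window-free text; what any proof of K1⁹ delivers on the flow side at its witness slot

Cell `pub-ymgap`, WIDTH SEAT `pub-ymgap-dag-n13-w4` (gen 7).  `--kind proof --supports stmt-QuantumFields-27364 --as helper` (count-neutral; dag-lead KEY MAP v2 ∕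
GATE v1.69).  [I] = [Balaban1987RG1] Commun. Math. Phys. **109** (1987); [III] = [Balaban1988Convergent] Commun. Math. Phys. **119** (1988);
[V] = [Balaban1989LargeFieldII] Commun. Math. Phys. **122** (1989).

WHY.  Route rev 28∕29 (plan g85 `D85-REV28`, director-ym №210 (δ) «null-set surgery — def-level first, route second») re-typed the deciding crux through
DEF-1's VERSION SLOT (`Node00/Record13SepCoPHV.lean`, p620607): K1⁹ reads, at its witness `(θ, h, v)`, «(unity ∧ slots) ∧ Admissible ∧ (B) AS PRINTED at the
re-chosen datum `Node00.datumOfRecord₁₃SepCoPHV F 2 θ h v` ∧ THE NON-VACUITY WINDOW at that datum (`∃ γ₁ > 0, ∀ γ ∈ ]0,γ₁], ∃ P, 1 ≤ P.K ∧ InInterval γ P.K`) ∧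
THE RUN ROWS of `β_θ := Node00.betaOfRecord₁₃ F 2 θ.toStage13Params` on SOME level `γ₀ > 0`: (i) run-wise constant remainder, (iv) run-wise partial-sum floor,
(C) run-wise survivor continuity».  This file records the KERNEL FACT that the window conjunct is IMPLIED BY ROW (i) OF THE SAME BUNDLE at EVERY slot `v`
(the slot re-chooses densities above level `0`; the coupling flow and `βfun` are slot-free — DEF-1's faces `Node00.flow_datumOfRecord₁₃SepCoPHV` ∕
`Node00.βfun_datumOfRecord₁₃SepCoPHV`, both `rfl` — and row (i) ALONE puts runs of EVERY length inside ONE window, this lineage's file 8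
`…K1WindowKOfRunRows.windowK_uniform_of_runConstRemainder` at any `FiniteEpsData`).  Hence the deciding crux is EQUIVALENT to its window-free text (§2), and so
is the aside K1⁸ (stmt-QuantumFields-26907) — the fact predates the slot.  §3 lists, BY THE ROUTE NAME, what any proof of K1⁹ delivers on the flow side at its
witness slot: runs of every length in one window solving (0.20); (B) BITING at EVERY level on runs of every length for the RE-CHOSEN densities' construction
`(datumOfRecord₁₃SepCoPHV … v).C` (genuinely slot-dependent: Cor. 3 (2.50) is asked pointwise of `v.ρ`); and K3⁸'s antecedent pair «(B)ⱽ ∧ END at the slot datum»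
(K2⁹'s content at the K1⁹ witness — `closes`' first two steps — through this lineage's g5 §5 and DEF-1's `toB12` face).  §4 transports the β-BOUND-FREE END
CRITERION of file 12 (`…K1EndCriterionCeilingFree`) to every slot datum.

NOT IN THIS FILE (others' lanes, not restated): DEF-1's `Iff.rfl` item mirrors, slot faces `window_…V_iff`, doors and the per-tuple use form «rows ⟹ END at the
slot» (`Thm/…K1R9VersionSlotDefs`, INTENT-11) and the K2⁹ closer (OFFER-K2R9); the (B)-side a.e. ⇄ slot junctions (dag-n13-w1 `…K1R9VersionSlotOfAEAtRecord`,
dag-n13-w2∕w3); K1⁹ by name from the open stubs (dag-n24-c).  HONEST FRAMING: [folklore] quantifier bookkeeping over this lineage's files 8∕9∕12 and DEF-1's slot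
faces; every β-side letter is a HYPOTHESIS SHAPE; nothing of Bałaban asserted; nothing about `Node00.betaOfRecord₁₃` proved; NO stub of the registered K1 v8
skeleton (`stub_nodes13PWS` ∕ `stub_runRows13PWS` ∕ `stub_cont13`) closed; K1⁹ ∕ K3⁸ ∕ K0⁷ OPEN; N13 NOT discharged; counts unmoved (typed 28∕28 · discharged 5∕27 ·
A 5∕28); one finite 𝕋⁴ programme at fixed `ε = L^{-K}`, Bałaban AS PRINTED; R4 closes ONLY the CONDITIONAL finite-𝕋⁴ rung `BalabanLadder.UV` — NOT continuum ∕ ℝ⁴ ∕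
OS ∕ mass gap; the Yang–Mills mass gap (Clay) is NOT proved by any of this.  No `def`, no `instance`, no `notation`, no `axiom`.
-/

noncomputable section

open scoped Matrix.Norms.L2Operator

namespace Summit.QuantumFields.YangMills.Theorems.BalabanUVNodesK1R9WindowConjunctIdle

open Literature.MathematicalPhysics.QuantumFieldTheory.Balaban1983to89
open Literature.MathematicalPhysics.QuantumFieldTheory.Balaban1983to89.FlowStep
open Literature.MathematicalPhysics.QuantumFieldTheory.Balaban1983to89.FlowStepRuns
open Literature.MathematicalPhysics.QuantumFieldTheory.Balaban1983to89.DagBinding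
open Literature.MathematicalPhysics.QuantumFieldTheory.Balaban1983to89.T4Continuum (T4Family FiniteEpsData)
open Summit.QuantumFields.YangMills.Theorems.BalabanUVNodesK2NamedJetsRunRemAt (RunConstRemainder SurvCont Survivors)
open Summit.QuantumFields.YangMills.Theorems.K1V6Defs (Inhabited13 Window)
open Summit.QuantumFields.YangMills.Theorems.BalabanUVNodesK1R8RowsDefs (RunRowsCont13)
open Summit.QuantumFields.YangMills.Theorems.BalabanUVNodesK1WindowKOfRunRows (windowK_uniform_of_runConstRemainder
  bitesAllK_of_endStatementBPrinted_of_windowKUniform)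
open Summit.QuantumFields.YangMills.Theorems.BalabanUVNodesK1WindowKOfRunRowsSurvivors (endpointExistence_datumOfRecord₁₃SepCoPH_of_runRows_survCont)
open Summit.QuantumFields.YangMills.Theorems.BalabanUVNodesK1EndCriterionCeilingFree (haltsOutside_datumOfRecord₁₃SepCoPH
  endpointExistence_datumOfRecord₁₃SepCoPH_iff_windowRuns_topRuns)

/-! ## §1 Row (i) gives the window at EVERY version slot (general `N`) -/

section Slot

variable {F : T4Family} {N : ℕ} [NeZero N]

/-- ★ **AT EVERY VERSION SLOT, ROW (i) ALONE ⟹ RUNS OF EVERY LENGTH INSIDE ONE WINDOW, SOLVING (0.20)** (general `N`, every proviso witness `h`, EVERY revision `v`):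
`RunConstRemainder (betaOfRecord₁₃ F N θ) b r γ₀` ⟹ for every `γ ∈ ]0, γ₀]`, every `K` and `m` some bare coupling `g₀ ∈ ]0, γ]` whose run `⟨K, m, g₀⟩` of the RE-CHOSEN datum's
construction `(datumOfRecord₁₃SepCoPHV F N θ h v).C` stays in `]0, γ]` up to `K` and solves (0.20) up to `K`.  File 8's `FiniteEpsData` theorem read at the slot datum, whose `βfun`
is `betaOfRecord₁₃ θ` (DEF-1's face, `rfl`): the slot re-chooses densities, never the flow.  DISPLAYED hypothesis (NODE O's), not discharged.
[cite: Balaban1987RG1, (0.17)–(0.20) pp.255–256, Thm 2 p.259, (1.20)–(1.22) p.264, Thm 3 p.264, (5.10) p.293; Balaban1989LargeFieldII, Thm 1 + (0.1) pp.355–356 (bookkeeping + elementary)] -/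
theorem windowK_uniform_datumOfRecord₁₃SepCoPHV_of_runConstRemainder (θ : Node00.Stage13HParams F N) (h : θ.Provisos₁₃SepCoPH F N)
    (v : Node00.Revision₁₃ F N θ h) {b : ℕ → ℝ} {r γ₀ : ℝ} (hrem : RunConstRemainder (Node00.betaOfRecord₁₃ F N θ.toStage13Params) b r γ₀) :
    ∀ γ : ℝ, 0 < γ → γ ≤ γ₀ → ∀ K m : ℕ, ∃ g0 : ℝ, (0 < g0 ∧ g0 ≤ γ) ∧
      ((Node00.datumOfRecord₁₃SepCoPHV F N θ h v).C ⟨K, m, g0⟩).flow.InInterval γ K ∧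
        ((Node00.datumOfRecord₁₃SepCoPHV F N θ h v).C ⟨K, m, g0⟩).flow.SatisfiesRG K :=
  windowK_uniform_of_runConstRemainder (Node00.datumOfRecord₁₃SepCoPHV F N θ h v) hrem

/-- **ROW (i) IN THE ITEM'S INLINE SPELLING ⟹ THE ITEM'S WINDOW CONJUNCT AT THE SLOT DATUM** (general `N`, every `v`; `γ₁ := γ₀`, the run has length `1`): the `∃ γ₁` non-vacuity
window K1⁹ asks at `datumOfRecord₁₃SepCoPHV F N θ h v` is implied by its own row (i) «`∀ n gs, RGEqH n β_θ gs → Step.InInterval γ₀ n gs → ∀ k ≤ n, |β_θ k (prefixOf gs k) − b k| ≤ r`»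
with `0 < γ₀`.  [folklore] quantifier bookkeeping over the previous theorem. [cite: Balaban1987RG1, (0.17)–(0.20) pp.255–256, Thm 3 p.264 (bookkeeping)] -/
theorem windowItem_datumOfRecord₁₃SepCoPHV_of_rowI (θ : Node00.Stage13HParams F N) (h : θ.Provisos₁₃SepCoPH F N) (v : Node00.Revision₁₃ F N θ h)
    {b : ℕ → ℝ} {r γ₀ : ℝ} (hγ₀ : 0 < γ₀)
    (hrowI : ∀ (n : ℕ) (gs : ℕ → ℝ), RGEqH n (Node00.betaOfRecord₁₃ F N θ.toStage13Params) gs → Step.InInterval γ₀ n gs →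
      ∀ k, k ≤ n → |Node00.betaOfRecord₁₃ F N θ.toStage13Params k (prefixOf gs k) - b k| ≤ r) :
    ∃ γ₁ : ℝ, 0 < γ₁ ∧ ∀ γ : ℝ, 0 < γ → γ ≤ γ₁ → ∃ P : B12.RunParams, 1 ≤ P.K ∧
      ((Node00.datumOfRecord₁₃SepCoPHV F N θ h v).C P).flow.InInterval γ P.K := by
  refine ⟨γ₀, hγ₀, fun γ hγ hγle => ?_⟩
  obtain ⟨g0, -, hI, -⟩ := windowK_uniform_datumOfRecord₁₃SepCoPHV_of_runConstRemainder θ h v hrowI γ hγ hγle 1 0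
  exact ⟨⟨1, 0, g0⟩, le_rfl, hI⟩

/-- **… AND FOR EVERY `K ≥ 1` IN THE SAME WINDOW** (the K-indexed form of the item's window conjunct: for every `γ ∈ ]0, γ₀]` and every `K`, a run `P` with `P.K = K` in `]0, γ]`),
general `N`, every `v`. [cite: Balaban1987RG1, (0.17)–(0.20) pp.255–256, Thm 3 p.264 (bookkeeping)] -/
theorem windowItemK_datumOfRecord₁₃SepCoPHV_of_rowI (θ : Node00.Stage13HParams F N) (h : θ.Provisos₁₃SepCoPH F N) (v : Node00.Revision₁₃ F N θ h)
    {b : ℕ → ℝ} {r γ₀ : ℝ}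
    (hrowI : ∀ (n : ℕ) (gs : ℕ → ℝ), RGEqH n (Node00.betaOfRecord₁₃ F N θ.toStage13Params) gs → Step.InInterval γ₀ n gs →
      ∀ k, k ≤ n → |Node00.betaOfRecord₁₃ F N θ.toStage13Params k (prefixOf gs k) - b k| ≤ r) :
    ∀ γ : ℝ, 0 < γ → γ ≤ γ₀ → ∀ K m : ℕ, ∃ P : B12.RunParams, P.K = K ∧ P.m = m ∧ (0 < P.g0 ∧ P.g0 ≤ γ) ∧
      ((Node00.datumOfRecord₁₃SepCoPHV F N θ h v).C P).flow.InInterval γ P.K := by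
  intro γ hγ hγle K m
  obtain ⟨g0, hg0, hI, -⟩ := windowK_uniform_datumOfRecord₁₃SepCoPHV_of_runConstRemainder θ h v hrowI γ hγ hγle K m
  exact ⟨⟨K, m, g0⟩, rfl, rfl, hg0, hI⟩

/-- `N = 2`, BY NAME: row (i) at `θ` ⟹ K1 v6's `Window` predicate (`K1V6Defs.Window`, the crux's window conjunct as a tree name) at EVERY slot datum `datumOfRecord₁₃SepCoPHV F 2 θ h v`.
[cite: Balaban1987RG1, (0.17)–(0.20) pp.255–256, Thm 3 p.264 (bookkeeping)] -/
theorem window_datumOfRecord₁₃SepCoPHV_of_runConstRemainder {F : T4Family} (θ : Node00.Stage13HParams F 2) (h : θ.Provisos₁₃SepCoPH F 2)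
    (v : Node00.Revision₁₃ F 2 θ h) {b : ℕ → ℝ} {r γ₀ : ℝ} (hγ₀ : 0 < γ₀)
    (hrem : RunConstRemainder (Node00.betaOfRecord₁₃ F 2 θ.toStage13Params) b r γ₀) :
    Window (Node00.datumOfRecord₁₃SepCoPHV F 2 θ h v) :=
  windowItem_datumOfRecord₁₃SepCoPHV_of_rowI θ h v hγ₀ hrem

/-- `N = 2`, BY NAME: the ROWS CONJUNCT of K1⁹ at `θ` (`K1R8RowsDefs.RunRowsCont13 F θ`, DEF-1's tree name; rows (i)(iv)(C) on some level `γ₀ > 0`) ⟹ `Window` at EVERY slot datum — only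
row (i) is read. [cite: Balaban1987RG1, (0.17)–(0.20) pp.255–256, Thm 3 p.264 (bookkeeping)] -/
theorem window_datumOfRecord₁₃SepCoPHV_of_runRowsCont13 {F : T4Family} (θ : Node00.Stage13HParams F 2) (h : θ.Provisos₁₃SepCoPH F 2)
    (v : Node00.Revision₁₃ F 2 θ h) (hrows : RunRowsCont13 F θ) : Window (Node00.datumOfRecord₁₃SepCoPHV F 2 θ h v) := by
  obtain ⟨b, r, γ₀, M, hγ₀, hrem, -, -⟩ := hrows
  exact window_datumOfRecord₁₃SepCoPHV_of_runConstRemainder θ h v hγ₀ hrem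

end Slot

/-! ## §2 The deciding crux ⟺ its window-free text (`N = 2`); the same for the aside K1⁸ -/

section WindowFree

/-- ★★ **K1⁹ FROM ITS WINDOW-FREE TEXT** (kernel): «`∀ F, Inhabited13 F → ∃ θ h v, (unity ∧ slots) ∧ Admissible ∧ (B) at the slot datum ∧ RunRowsCont13 F θ`» ⟹ the route decl
`…Theses.BalabanUVNodes.StabilityBRunRowsAtRecordR13SepCoPHV` (stmt-QuantumFields-27364) BY NAME — the `∃ γ₁` window conjunct is supplied by row (i) of the same bundle at the same
slot (§1).  CONDITIONAL on the displayed hypothesis; K1⁹ NOT closed; nothing of Bałaban asserted. [cite: Balaban1989LargeFieldII, Thm 1 + (0.1) pp.355–356; Balaban1988Convergent, Cor. 3 (2.50) p.264; Balaban1987RG1, Thm 3 p.264, (5.10) p.293, §1 pp.263–264 (bookkeeping)] -/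
theorem stabilityBRunRowsAtRecordR13SepCoPHV_of_windowFree
    (hwf : ∀ F : T4Family, Inhabited13 F → ∃ (θ : Node00.Stage13HParams F 2) (h : θ.Provisos₁₃SepCoPH F 2) (v : Node00.Revision₁₃ F 2 θ h),
      (θ.ZhUnity F 2 ∧ θ.SlotsNondegenerate₁₃ F 2) ∧ θ.Admissible F 2 ∧ B16.EndStatementBPrinted (Node00.datumOfRecord₁₃SepCoPHV F 2 θ h v).C ∧ RunRowsCont13 F θ) :
    Summit.QuantumFields.YangMills.Theses.BalabanUVNodes.StabilityBRunRowsAtRecordR13SepCoPHV := by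
  intro F hinh
  obtain ⟨θ, h, v, hU, hθ, hB, hrows⟩ := hwf F hinh
  obtain ⟨b, r, γ₀, M, hγ₀, hrem, hps, hsc⟩ := hrows
  exact ⟨θ, h, v, hU, hθ, hB, windowItem_datumOfRecord₁₃SepCoPHV_of_rowI θ h v hγ₀ hrem, b, r, γ₀, M, hγ₀, hrem, hps, hsc⟩

/-- **… AND CONVERSELY** (drop the window conjunct). [folklore] -/
theorem windowFree_of_stabilityBRunRowsAtRecordR13SepCoPHV (hK1 : Summit.QuantumFields.YangMills.Theses.BalabanUVNodes.StabilityBRunRowsAtRecordR13SepCoPHV) :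
    ∀ F : T4Family, Inhabited13 F → ∃ (θ : Node00.Stage13HParams F 2) (h : θ.Provisos₁₃SepCoPH F 2) (v : Node00.Revision₁₃ F 2 θ h),
      (θ.ZhUnity F 2 ∧ θ.SlotsNondegenerate₁₃ F 2) ∧ θ.Admissible F 2 ∧ B16.EndStatementBPrinted (Node00.datumOfRecord₁₃SepCoPHV F 2 θ h v).C ∧ RunRowsCont13 F θ := by
  intro F hinh
  obtain ⟨θ, h, v, hU, hθ, hB, -, hrows⟩ := hK1 F hinh
  exact ⟨θ, h, v, hU, hθ, hB, hrows⟩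

/-- ★★ **THE DECIDING CRUX ⟺ ITS WINDOW-FREE TEXT** (kernel): K1⁹ `…Theses.BalabanUVNodes.StabilityBRunRowsAtRecordR13SepCoPHV` holds iff «`∀ F, Inhabited13 F → ∃ θ h v, (unity ∧ slots) ∧
Admissible ∧ B16.EndStatementBPrinted (datumOfRecord₁₃SepCoPHV F 2 θ h v).C ∧ RunRowsCont13 F θ`» — its `∃ γ₁` window conjunct carries no content beyond row (i).  A DISPLAY INPUT for the
planner of record (a one-conjunct-lighter text is available); nothing re-typed here; count-neutral. [cite: Balaban1989LargeFieldII, Thm 1 + (0.1) pp.355–356; Balaban1987RG1, Thm 3 p.264, (5.10) p.293, §1 pp.263–264 (bookkeeping)] -/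
theorem stabilityBRunRowsAtRecordR13SepCoPHV_iff_windowFree :
    Summit.QuantumFields.YangMills.Theses.BalabanUVNodes.StabilityBRunRowsAtRecordR13SepCoPHV ↔
      ∀ F : T4Family, Inhabited13 F → ∃ (θ : Node00.Stage13HParams F 2) (h : θ.Provisos₁₃SepCoPH F 2) (v : Node00.Revision₁₃ F 2 θ h),
        (θ.ZhUnity F 2 ∧ θ.SlotsNondegenerate₁₃ F 2) ∧ θ.Admissible F 2 ∧ B16.EndStatementBPrinted (Node00.datumOfRecord₁₃SepCoPHV F 2 θ h v).C ∧ RunRowsCont13 F θ :=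
  ⟨windowFree_of_stabilityBRunRowsAtRecordR13SepCoPHV, stabilityBRunRowsAtRecordR13SepCoPHV_of_windowFree⟩

/-- **THE SAME FOR THE ASIDE K1⁸** (stmt-QuantumFields-26907, rev 26ᴿ∕27; history): `…Theses.BalabanUVNodes.StabilityBRunRowsAtRecordR13SepCoPH ↔ ∀ F, Inhabited13 F → ∃ θ h, (unity ∧ slots) ∧
Admissible ∧ B16.EndStatementBPrinted (datumOfRecord₁₃SepCoPH F 2 θ h).C ∧ RunRowsCont13 F θ` — the idle-window fact predates the slot (the unrevised datum is the slot datum at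
`Revision₁₃.refl`, DEF-1's door `rfl`). [cite: Balaban1989LargeFieldII, Thm 1 + (0.1) pp.355–356; Balaban1987RG1, Thm 3 p.264, (5.10) p.293, §1 pp.263–264 (bookkeeping)] -/
theorem stabilityBRunRowsAtRecordR13SepCoPH_iff_windowFree :
    Summit.QuantumFields.YangMills.Theses.BalabanUVNodes.StabilityBRunRowsAtRecordR13SepCoPH ↔
      ∀ F : T4Family, Inhabited13 F → ∃ (θ : Node00.Stage13HParams F 2) (h : θ.Provisos₁₃SepCoPH F 2),
        (θ.ZhUnity F 2 ∧ θ.SlotsNondegenerate₁₃ F 2) ∧ θ.Admissible F 2 ∧ B16.EndStatementBPrinted (Node00.datumOfRecord₁₃SepCoPH F 2 θ h).C ∧ RunRowsCont13 F θ := by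
  refine ⟨fun hK1 F hinh => ?_, fun hwf F hinh => ?_⟩
  · obtain ⟨θ, h, hU, hθ, hB, -, hrows⟩ := hK1 F hinh
    exact ⟨θ, h, hU, hθ, hB, hrows⟩
  · obtain ⟨θ, h, hU, hθ, hB, hrows⟩ := hwf F hinh
    obtain ⟨b, r, γ₀, M, hγ₀, hrem, hps, hsc⟩ := hrows
    exact ⟨θ, h, hU, hθ, hB, windowItem_datumOfRecord₁₃SepCoPHV_of_rowI θ h (Node00.Revision₁₃.refl F 2 θ h) hγ₀ hrem,
      b, r, γ₀, M, hγ₀, hrem, hps, hsc⟩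

end WindowFree

/-! ## §3 What any proof of K1⁹ delivers on the flow side at its witness slot (by the route name; `N = 2`) -/

section Delivers

/-- **RUNS OF EVERY LENGTH IN ONE WINDOW AT THE WITNESS SLOT**: any proof of K1⁹ yields `(θ, h, v)` with (unity ∧ slots), admissibility, (B) at the slot datum and a level `γ₀ > 0` in
each of whose sub-windows `]0, γ]` runs `⟨K, m, g₀⟩` of EVERY length and torus exponent stay and solve (0.20) — MORE than the item's `∃ P, 1 ≤ P.K` conjunct.  CONDITIONAL on K1⁹ (OPEN).
[cite: Balaban1987RG1, (0.17)–(0.20) pp.255–256, Thm 2 p.259, Thm 3 p.264; Balaban1989LargeFieldII, Thm 1 + (0.1) pp.355–356 (bookkeeping)] -/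
theorem windowKUniform_of_stabilityBRunRowsAtRecordR13SepCoPHV
    (hK1 : Summit.QuantumFields.YangMills.Theses.BalabanUVNodes.StabilityBRunRowsAtRecordR13SepCoPHV) :
    ∀ F : T4Family, Inhabited13 F → ∃ (θ : Node00.Stage13HParams F 2) (h : θ.Provisos₁₃SepCoPH F 2) (v : Node00.Revision₁₃ F 2 θ h),
      (θ.ZhUnity F 2 ∧ θ.SlotsNondegenerate₁₃ F 2) ∧ θ.Admissible F 2 ∧ B16.EndStatementBPrinted (Node00.datumOfRecord₁₃SepCoPHV F 2 θ h v).C ∧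
      ∃ γ₀ : ℝ, 0 < γ₀ ∧ ∀ γ : ℝ, 0 < γ → γ ≤ γ₀ → ∀ K m : ℕ, ∃ g0 : ℝ, (0 < g0 ∧ g0 ≤ γ) ∧
        ((Node00.datumOfRecord₁₃SepCoPHV F 2 θ h v).C ⟨K, m, g0⟩).flow.InInterval γ K ∧
          ((Node00.datumOfRecord₁₃SepCoPHV F 2 θ h v).C ⟨K, m, g0⟩).flow.SatisfiesRG K := by
  intro F hinh
  obtain ⟨θ, h, v, hU, hθ, hB, -, b, r, γ₀, M, hγ₀, hrem, -, -⟩ := hK1 F hinh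
  exact ⟨θ, h, v, hU, hθ, hB, γ₀, hγ₀, windowK_uniform_datumOfRecord₁₃SepCoPHV_of_runConstRemainder θ h v hrem⟩

/-- ★ **(B) BITES AT EVERY LEVEL ON RUNS OF EVERY LENGTH FOR THE RE-CHOSEN DENSITIES**: any proof of K1⁹ yields `(θ, h, v)`, level-independent `e_±` and ONE `γ_B > 0` such that for every
`γ ∈ ]0, γ_B]`, every `K` and `m` some run `⟨K, m, g₀⟩` of the slot construction `(datumOfRecord₁₃SepCoPHV F 2 θ h v).C` lies in `]0, γ]`, carries [III]'s §2 description `Sect2Form k` at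
every `k ≤ K`, and satisfies Cor. 3's (2.50) `B16.UVIneq … k V (e₋ g_k) (e₊ g_k)` at EVERY level `k ≤ K` and EVERY configuration `V` of the RE-CHOSEN densities `v.ρ` — no level of (B) is
vacuous at the witness, and the statement is genuinely about the slot ((2.50) reads `v.ρ` pointwise).  File 8 §4's generic-`C` theorem at `C := (datumⱽ v).C`, window from row (i).
CONDITIONAL on K1⁹ (OPEN); N13 NOT discharged. [cite: Balaban1989LargeFieldII, Thm 1 + (0.1) pp.355–356; Balaban1988Convergent, Cor. 3 (2.50) p.264; Balaban1987RG1, Thm 2 p.259, Thm 3 p.264 (bookkeeping)] -/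
theorem bitesAllK_of_stabilityBRunRowsAtRecordR13SepCoPHV
    (hK1 : Summit.QuantumFields.YangMills.Theses.BalabanUVNodes.StabilityBRunRowsAtRecordR13SepCoPHV) :
    ∀ F : T4Family, Inhabited13 F → ∃ (θ : Node00.Stage13HParams F 2) (h : θ.Provisos₁₃SepCoPH F 2) (v : Node00.Revision₁₃ F 2 θ h),
      (θ.ZhUnity F 2 ∧ θ.SlotsNondegenerate₁₃ F 2) ∧ θ.Admissible F 2 ∧
      ∃ em ep : ℝ → ℝ, ∃ γB : ℝ, 0 < γB ∧ ∀ γ : ℝ, 0 < γ → γ ≤ γB → ∀ K m : ℕ, ∃ g0 : ℝ, 0 < g0 ∧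
        ((Node00.datumOfRecord₁₃SepCoPHV F 2 θ h v).C ⟨K, m, g0⟩).flow.InInterval γ K ∧
          (∀ k, k ≤ K → ((Node00.datumOfRecord₁₃SepCoPHV F 2 θ h v).C ⟨K, m, g0⟩).Sect2Form k) ∧
            ∀ k, k ≤ K → ∀ V : ((Node00.datumOfRecord₁₃SepCoPHV F 2 θ h v).C ⟨K, m, g0⟩).Cfg k,
              B16.UVIneq ((Node00.datumOfRecord₁₃SepCoPHV F 2 θ h v).C ⟨K, m, g0⟩) k V
                (em (((Node00.datumOfRecord₁₃SepCoPHV F 2 θ h v).C ⟨K, m, g0⟩).flow.g k))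
                (ep (((Node00.datumOfRecord₁₃SepCoPHV F 2 θ h v).C ⟨K, m, g0⟩).flow.g k)) := by
  intro F hinh
  obtain ⟨θ, h, v, hU, hθ, hB, -, b, r, γ₀, M, hγ₀, hrem, -, -⟩ := hK1 F hinh
  refine ⟨θ, h, v, hU, hθ, bitesAllK_of_endStatementBPrinted_of_windowKUniform _ hB ⟨γ₀, hγ₀, fun γ hγ hγle K m => ?_⟩⟩
  obtain ⟨g0, hg0, hI, -⟩ := windowK_uniform_datumOfRecord₁₃SepCoPHV_of_runConstRemainder θ h v hrem γ hγ hγle K m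
  exact ⟨g0, hg0.1, hI⟩

/-- **K3⁸'s ANTECEDENT PAIR AT THE K1⁹ WITNESS FROM K1⁹ ALONE**: any proof of K1⁹ yields `(θ, h, v)` with (unity ∧ slots), admissibility, (B) at the slot datum AND
`EndpointExistence (datumOfRecord₁₃SepCoPHV F 2 θ h v).C.toB12` — rows (i)+(iv)+(C) at the witness give the END (this lineage's g5 §5 `endpointExistence_datumOfRecord₁₃SepCoPH_of_runRows_survCont`,
the datum forward-generated by its own β of record), transported along DEF-1's version-free `toB12` face (`rfl`).  = `closes`' first two steps by name (K2⁹'s content at the witness);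
K2⁹'s own one-line closer is DEF-1's (OFFER-K2R9), not restated.  CONDITIONAL on K1⁹ (OPEN); [I] Thm 2 p.259 (first sentence) and (C) §1 pp.263–264 UNPROVED in print.
[cite: Balaban1987RG1, Thm 2 p.259 (first sentence), Thm 3 p.264, (5.10) p.293, §1 pp.263–264; Balaban1989LargeFieldII, Thm 1 + (0.1) pp.355–356 (bookkeeping)] -/
theorem endpointExistence_of_stabilityBRunRowsAtRecordR13SepCoPHV
    (hK1 : Summit.QuantumFields.YangMills.Theses.BalabanUVNodes.StabilityBRunRowsAtRecordR13SepCoPHV) :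
    ∀ F : T4Family, Inhabited13 F → ∃ (θ : Node00.Stage13HParams F 2) (h : θ.Provisos₁₃SepCoPH F 2) (v : Node00.Revision₁₃ F 2 θ h),
      (θ.ZhUnity F 2 ∧ θ.SlotsNondegenerate₁₃ F 2) ∧ θ.Admissible F 2 ∧ B16.EndStatementBPrinted (Node00.datumOfRecord₁₃SepCoPHV F 2 θ h v).C ∧
        EndpointExistence (Node00.datumOfRecord₁₃SepCoPHV F 2 θ h v).C.toB12 := by
  intro F hinh
  obtain ⟨θ, h, v, hU, hθ, hB, -, b, r, γ₀, M, hγ₀, hrem, hps, hsc⟩ := hK1 F hinh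
  refine ⟨θ, h, v, hU, hθ, hB, ?_⟩
  rw [Node00.toB12_datumOfRecord₁₃SepCoPHV]
  exact endpointExistence_datumOfRecord₁₃SepCoPH_of_runRows_survCont θ h hγ₀ hrem hps hsc

end Delivers

/-! ## §4 The β-bound-free END criterion at every slot datum (general `N`) -/

section Criterion

variable {F : T4Family} {N : ℕ} [NeZero N]

/-- **`HaltsOutside` AT EVERY SLOT DATUM** (the third modelling clause of `FlowStepRuns`; the slot construction's `toB12` is the record's — DEF-1's face, `rfl` — so file 12's
`haltsOutside_datumOfRecord₁₃SepCoPH` transports verbatim). [cite: Balaban1987RG1, (0.18)–(0.20) pp.255–256 (bookkeeping: the coupling recursion of record)] -/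
theorem haltsOutside_datumOfRecord₁₃SepCoPHV (θ : Node00.Stage13HParams F N) (h : θ.Provisos₁₃SepCoPH F N) (v : Node00.Revision₁₃ F N θ h) :
    HaltsOutside (Node00.datumOfRecord₁₃SepCoPHV F N θ h v).C.toB12 (Node00.betaOfRecord₁₃ F N θ.toStage13Params) :=
  haltsOutside_datumOfRecord₁₃SepCoPH θ h

/-- ★ **THE β-BOUND-FREE END CRITERION AT EVERY SLOT DATUM**: at every Stage-13 tuple `θ` with provisos `h` and EVERY revision `v`, GIVEN survivor continuity (C) of
`β_θ := betaOfRecord₁₃ F N θ.toStage13Params` at a level `γ₀ > 0` and non-crossing of its in-window (0.20)-runs below `γ₀` (NODE O's letters, not asserted),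
`EndpointExistence (datumOfRecord₁₃SepCoPHV F N θ h v).C.toB12 ↔ ∃ γ₂ > 0, ∀ γ ∈ ]0,γ₂], (runs of every length in ]0,γ]) ∧ (a top-run threshold at γ)` — NO bound on `β_θ` of any kind; K2⁹'s
consequent at `(θ, h, v)` in exact form.  File 12's criterion at the record transported along DEF-1's `toB12` face (`rfl`).
[cite: Balaban1987RG1, Thm 2 p.259 (first sentence), (0.17)–(0.20) pp.255–256, §1 pp.263–264, §5 p.298; Balaban1989LargeFieldII, Thm 1 + (0.1) pp.355–356 (bookkeeping)] -/
theorem endpointExistence_datumOfRecord₁₃SepCoPHV_iff_windowRuns_topRuns (θ : Node00.Stage13HParams F N) (h : θ.Provisos₁₃SepCoPH F N) (v : Node00.Revision₁₃ F N θ h)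
    {γ₀ : ℝ} (hγ₀ : 0 < γ₀) (hsc : SurvCont (Node00.betaOfRecord₁₃ F N θ.toStage13Params) γ₀)
    (hord : ∀ γ : ℝ, 0 < γ → γ ≤ γ₀ → ∀ (n : ℕ) (gs gs' : ℕ → ℝ), RGEqH n (Node00.betaOfRecord₁₃ F N θ.toStage13Params) gs →
      RGEqH n (Node00.betaOfRecord₁₃ F N θ.toStage13Params) gs' → Step.InInterval γ n gs → Step.InInterval γ n gs' → gs 0 < gs' 0 → ∀ k, k ≤ n → gs k < gs' k) :
    EndpointExistence (Node00.datumOfRecord₁₃SepCoPHV F N θ h v).C.toB12 ↔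
      ∃ γ₂ : ℝ, 0 < γ₂ ∧ ∀ γ : ℝ, 0 < γ → γ ≤ γ₂ →
        (∀ K : ℕ, ∃ gs : ℕ → ℝ, RGEqH K (Node00.betaOfRecord₁₃ F N θ.toStage13Params) gs ∧ Step.InInterval γ K gs) ∧
        ∃ gstar : ℝ, 0 < gstar ∧ ∀ (n : ℕ) (gs : ℕ → ℝ), RGEqH n (Node00.betaOfRecord₁₃ F N θ.toStage13Params) gs → Step.InInterval γ n gs →
          ∀ k, k ≤ n → gs k = γ → gstar ≤ gs n := by
  rw [Node00.toB12_datumOfRecord₁₃SepCoPHV]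
  exact endpointExistence_datumOfRecord₁₃SepCoPH_iff_windowRuns_topRuns θ h hγ₀ hsc hord

end Criterion

end Summit.QuantumFields.YangMills.Theorems.BalabanUVNodesK1R9WindowConjunctIdle

end
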